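import Mathlib
import Summits.Ventures.HodgeRepro2.T6N5Skeleton
import Summits.Ventures.HodgeRepro2.T6N5PropG

/-!
# T6N5Family — N5 over the twist family Ξ_𝔭: the (c)-side from Proposition G, the rest from
N5.5(g), carrier-free

Tier 6 (README §10), sub-step N5 of the M2 discharge (t6-p7).  TIER5 §N5.5(g) (ll. 1970–1979): the
family of (D3)/(D6) — the common twist ν̃ ∈ Ξ_𝔭 acting on the whole datum (χ_i ↦ χ_iν̃, β′ ↦ β′ν̃²) —
is admissible for Theorem 5.4 uniformly in ν̃: (a) holds for the twisted family by definition, (b)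
is ν̃-invariant, and «(c) is the only ν̃-dependent condition».  Route-3 §G (TIER5 ll. 505–546),
adopted by N5 at §N5.12, gives (c) for all but finitely many ν̃ (one cofinite statement per line
character — `T6N5PropG`).  This file composes the two: a family `D : Ξ → N5Data` of side data whose
members all satisfy Theorem 5.4 (`dichotomy`), Lemma N5.L1 (`levelReduction`), (a) and (b), together
with four Proposition-G branches whose central values are the members' `Lval`, yields N5 for SOME
member (`N5_of_propG`) — the form in which [G-N5.1] closes at M2 («for one admissible choice of the
finite parts, equivalently for some ν̃ ∈ Ξ_𝔭», TIER5 §N5.8).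

No display lives here.  §8(d): uses an L-value-free non-vanishing device: NO.
-/

namespace Summit.Ventures.HodgeRepro2.T6.N5Family

open Summit.Ventures.HodgeRepro2.T6.N5Skeleton Summit.Ventures.HodgeRepro2.T6.N5PropG

variable {Ξ ι G : Type*} [CommGroup G]

/-- N5 for some member of a twist family: Theorem 5.4 + N5.L1 + (a) + (b) for every member
(TIER5 §N5.5(g)) and (c) for one member give N5 for that member. -/
theorem N5_of_family (D : Ξ → N5Data ι G)
    (hT : ∀ ν, (D ν).A.dichotomy ∧ (D ν).B.dichotomy)
    (hL : ∀ ν, (D ν).A.levelReduction ∧ (D ν).B.levelReduction)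
    (ha : ∀ ν, (D ν).A.condA ∧ (D ν).B.condA)
    (hb : ∀ ν, (D ν).A.condB ∧ (D ν).B.condB)
    (hc : ∃ ν, (D ν).condC) : ∃ ν, (D ν).N5 := by
  obtain ⟨ν, hcν⟩ := hc
  exact ⟨ν, N5Data.N5_of_residual (hT ν).1 (hT ν).2 (hL ν).1 (hL ν).2 (ha ν).1 (ha ν).2
    (hb ν).1 (hb ν).2 hcν⟩


/-- (a) «discharged by the definition of β′» (TIER5 §N5.4 row (a), (D4)): if β′ is DEFINED as the
right side of (a_A) and S-H holds ((χ_{111}χ_{100})|_Δ = (χ_{101}χ_{110})|_Δ, N2 (A5)), then both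
(a_A) and (a_B) hold. -/
theorem condA_of_def (D : N5Data ι G) (hdef : D.A.β = D.A.f * D.A.r) (hSH : D.A.r = D.B.r) :
    D.A.condA ∧ D.B.condA :=
  ⟨hdef, by unfold ToricSide.condA; rw [← D.same_β, ← D.same_f, ← hSH]; exact hdef⟩

/-- TIER5 §N5.5(g) over the twist family: the local signs of (b) do not move under the twist, so (b)
for one member gives (b) for every member (both sides). -/
theorem condB_of_family (D : Ξ → N5Data ι G) (ν₀ : Ξ)
    (hω : ∀ ν, (D ν).A.omega = (D ν₀).A.omega ∧ (D ν).B.omega = (D ν₀).B.omega)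
    (hε : ∀ ν, (D ν).A.eps = (D ν₀).A.eps ∧ (D ν).B.eps = (D ν₀).B.eps)
    (hb : (D ν₀).A.condB ∧ (D ν₀).B.condB) : ∀ ν, (D ν).A.condB ∧ (D ν).B.condB := by
  intro ν
  refine ⟨fun v i => ?_, fun v i => ?_⟩
  · rw [(hω ν).1, (hε ν).1]; exact hb.1 v i
  · rw [(hω ν).2, (hε ν).2]; exact hb.2 v i

/-- The (c)-side from Proposition G: if the four central values of the members are the L-values of
four Proposition-G branches (`lineA i`, `lineB i` : the branches of the lines (111, 100) and
(101, 110)) whose hypotheses hold, and the twist family is infinite, then some member satisfies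
(c_A) ∧ (c_B) (the admissible choice of [G-N5.1]). -/
theorem exists_condC_of_propG {ι' K : Type*} [Field K] (D : Ξ → N5Data ι G)
    (hΞ : (Set.univ : Set Ξ).Infinite)
    (lineA lineB : Fin 2 → GBranch ι' Ξ K)
    (hA : ∀ i, (lineA i).Hyps) (hB : ∀ i, (lineB i).Hyps)
    (hLA : ∀ ν i, (D ν).A.Lval i = (lineA i).L ν) (hLB : ∀ ν i, (D ν).B.Lval i = (lineB i).L ν) :
    ∃ ν, (D ν).condC := by
  -- index the four branches by `Bool × Fin 2` (side, line) and apply Proposition G (ii) to all four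
  let br : Bool × Fin 2 → GBranch ι' Ξ K := fun p => if p.1 then lineB p.2 else lineA p.2
  have hbr : ∀ p ∈ (Finset.univ : Finset (Bool × Fin 2)), (br p).Hyps := by
    rintro ⟨b, i⟩ -
    cases b <;> simp only [br] <;> first | exact hA i | exact hB i
  obtain ⟨ν, hν⟩ := exists_twist_of_hyps hΞ Finset.univ br hbr
  refine ⟨ν, ?_, ?_⟩
  · -- (c_A): both L-values of side A are non-zero
    apply ToricSide.condC_of_ne_zero
    intro i
    rw [hLA ν i]
    simpa [br] using hν (false, i) (Finset.mem_univ _)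
  · apply ToricSide.condC_of_ne_zero
    intro i
    rw [hLB ν i]
    simpa [br] using hν (true, i) (Finset.mem_univ _)

/-- N5 FROM PROPOSITION G: the assembly of TIER5 §N5.1 over the twist family with (c) supplied by
route-3 §G — Theorem 5.4 ×2, N5.L1 ×2, (a) ×2, (b) ×2 for every member (N5.5(g)), the four
branches' hypotheses, and Ξ_𝔭 infinite give N5 for some member of the family. -/
theorem N5_of_propG {ι' K : Type*} [Field K] (D : Ξ → N5Data ι G)
    (hΞ : (Set.univ : Set Ξ).Infinite)
    (hT : ∀ ν, (D ν).A.dichotomy ∧ (D ν).B.dichotomy)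
    (hL : ∀ ν, (D ν).A.levelReduction ∧ (D ν).B.levelReduction)
    (ha : ∀ ν, (D ν).A.condA ∧ (D ν).B.condA)
    (hb : ∀ ν, (D ν).A.condB ∧ (D ν).B.condB)
    (lineA lineB : Fin 2 → GBranch ι' Ξ K)
    (hA : ∀ i, (lineA i).Hyps) (hB : ∀ i, (lineB i).Hyps)
    (hLA : ∀ ν i, (D ν).A.Lval i = (lineA i).L ν) (hLB : ∀ ν i, (D ν).B.Lval i = (lineB i).L ν) :
    ∃ ν, (D ν).N5 :=
  N5_of_family D hT hL ha hb (exists_condC_of_propG D hΞ lineA lineB hA hB hLA hLB)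

end Summit.Ventures.HodgeRepro2.T6.N5Family
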